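import Mathlib
import Summits.ValiantsHypothesis.ValiantsHypothesis.Theorems.DivisionGapShadowBirkhoffCounterDefs

/-!
# Lower hull vertices admit no additive re-splicing (line `Sketch-ideator4`, crux `DivisionGap.ShadowBirkhoff`)

Structural lemma for the crux `DivisionGap.ShadowBirkhoff` (stmt-ValiantsHypothesis-5069), line
`Sketch-ideator4`.  For a planar set `S`, `lowerVertices S` (object of
`Theorems/DivisionGapShadowBirkhoffCounterDefs.lean`) is the set of strict unique minimisers over `S` of
`p ↦ p.2 − μ·p.1` for some real slope `μ`, i.e. the vertices of the lower convex hull of `S` together with a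
supporting slope.  We show a 2-Sidon-type property: two lower vertices `pb, pc` with `pb.1 < pc.1` can never
be "re-spliced" as `pb + pc = pa + pd` by two points `pa, pd ∈ S` with `pa ≠ pb`, `pd ≠ pc` and `pd` strictly
to the right of `pc`.  In the application `S` is the value set of a weighted face of the Birkhoff polytope and
the relation `pa + pd = pb + pc` comes from exchanging alternating cycles between two perfect matchings, so
the lemma is a necessary condition on every witness of the crux.

Proof (elementary convex geometry): supporting slopes increase from left to right (`μb < μc`); testing the
minimality of `pb` against `pa = pb + pc − pd` gives `pd.2 − pc.2 < μb·(pd.1 − pc.1)`, testing the minimality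
of `pc` against `pd` gives `μc·(pd.1 − pc.1) < pd.2 − pc.2`, whence `μc < μb`, a contradiction.
-/

set_option linter.dupNamespace false

noncomputable section

open scoped BigOperators

namespace Summit.ValiantsHypothesis.ValiantsHypothesis.Theorems.DivisionGapShadowBirkhoff

/-- Supporting slopes of lower vertices increase from left to right: if `μb` strictly supports `S` at `pb`
and `μc` strictly supports `S` at `pc` with `pb.1 < pc.1`, then `μb < μc`. [folklore] -/
theorem lowerVertices_slope_lt {S : Set (ℝ × ℝ)} {pb pc : ℝ × ℝ} {μb μc : ℝ}
    (hbS : pb ∈ S) (hcS : pc ∈ S)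
    (Hb : ∀ q ∈ S, q ≠ pb → pb.2 - μb * pb.1 < q.2 - μb * q.1)
    (Hc : ∀ q ∈ S, q ≠ pc → pc.2 - μc * pc.1 < q.2 - μc * q.1)
    (hbc : pb.1 < pc.1) : μb < μc := by
  have hne : pb ≠ pc := by
    rintro rfl
    exact lt_irrefl _ hbc
  have h1 := Hb pc hcS (Ne.symm hne)
  have h2 := Hc pb hbS hne
  by_contra h
  have h3 : μc * (pc.1 - pb.1) ≤ μb * (pc.1 - pb.1) :=
    mul_le_mul_of_nonneg_right (not_lt.1 h) (sub_nonneg.2 hbc.le)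
  nlinarith [h1, h2, h3]

/-- **No additive re-splicing of lower hull vertices.**  If `pb, pc` are lower vertices of a planar set `S`
with `pb.1 < pc.1`, and `pa, pd ∈ S` with `pa ≠ pb`, `pd ≠ pc`, `pc.1 < pd.1`, then `pa + pd ≠ pb + pc`.
[folklore] -/
theorem lowerVertices_no_additive_quadruple {S : Set (ℝ × ℝ)} {pa pb pc pd : ℝ × ℝ}
    (hb : pb ∈ lowerVertices S) (hc : pc ∈ lowerVertices S) (ha : pa ∈ S) (hd : pd ∈ S)
    (hab : pa ≠ pb) (hdc : pd ≠ pc) (hbc : pb.1 < pc.1) (hcd : pc.1 < pd.1) :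
    pa + pd ≠ pb + pc := by
  obtain ⟨hbS, μb, Hb⟩ := hb
  obtain ⟨hcS, μc, Hc⟩ := hc
  -- (1) slopes increase from left to right
  have hslope : μb < μc := lowerVertices_slope_lt hbS hcS Hb Hc hbc
  -- (2) suppose `pa + pd = pb + pc` and split into components
  intro heq
  have h1 : pa.1 + pd.1 = pb.1 + pc.1 := by
    have := congrArg Prod.fst heq
    simpa using this
  have h2 : pa.2 + pd.2 = pb.2 + pc.2 := by
    have := congrArg Prod.snd heq
    simpa using this
  -- (3) minimality of `pb` tested against `pa`
  have hba := Hb pa ha hab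
  have e1 : μb * pa.1 = μb * pb.1 + μb * pc.1 - μb * pd.1 := by
    rw [show pa.1 = pb.1 + pc.1 - pd.1 by linarith]
    ring
  have hI : pd.2 - pc.2 < μb * (pd.1 - pc.1) := by nlinarith [hba, e1, h2]
  -- (4) minimality of `pc` tested against `pd`
  have hcd' := Hc pd hd hdc
  have hII : μc * (pd.1 - pc.1) < pd.2 - pc.2 := by nlinarith [hcd']
  -- (5) hence `μc < μb`, contradicting (1)
  have hpos : 0 < pd.1 - pc.1 := sub_pos.2 hcd
  have hlt : μc * (pd.1 - pc.1) < μb * (pd.1 - pc.1) := lt_trans hII hI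
  have hμ : μc < μb := lt_of_mul_lt_mul_right hlt hpos.le
  exact absurd (lt_trans hslope hμ) (lt_irrefl _)

end Summit.ValiantsHypothesis.ValiantsHypothesis.Theorems.DivisionGapShadowBirkhoff

end
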